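import Summits.NavierStokesRegularity.NavierStokesRegularity.Theorems.SelfMixingDichotomyCoherentScaleExclusionSwirlCoherence
import Summits.NavierStokesRegularity.NavierStokesRegularity.Theorems.SelfMixingDichotomyCoherentScaleExclusionMixDriftStability
import Summits.NavierStokesRegularity.NavierStokesRegularity.Theorems.SelfMixingDichotomyCoherentScaleExclusionMixMaxPrinciple
import Summits.NavierStokesRegularity.NavierStokesRegularity.Theorems.SelfMixingDichotomyMixingPayoffTypeIFloorAssembly
import HarnessLib

/-!
# Route SelfMixingDichotomy — crux `CoherentScaleExclusion` (S2, stmt-NavierStokesRegularity-1423), line `registered`,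
# lead c3: ROBUST swirl coherence — non-mixing is open around the sphere-tangential class

Support file (`--supports stmt-NavierStokesRegularity-1423`; registered sub-goal
`stub_notDissipatesAtScale_of_near_sphereTangential`).

`stub_sphereTangential_notDissipatesAtScale` (file `…SwirlCoherence`) says that a drift tangential to the spheres about the
centre never `δ`-mixes radial blobs (`δ ≤ δ₁`, every scale, any amplitude). THIS FILE makes the statement ROBUST: any drift
`u` in the well-posedness class whose distance to SOME sphere-tangential `v` is `L²`-small at the scale-invariant rate,
`∫ ‖u(t) − v(t)‖² ≤ c₀ r` on the window, is still `δ₂`-coherent at scale `r` (`δ₂ = δ₁/2`). Ingredients: the whole-space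
drift-stability estimate `stub_mixClass_driftStability` (MIX-class form of Johansson–Sorella 2024, Lemma 2.2:
`∫ (θ₁ − θ₂)(t)² ≤ M² V (t − a)`), the two-sided maximum principle `stub_mixClass_abs_le_of_datum` (`|θ_heat| ≤ 1`), the
heat bump floor `stub_heatBumpFloor_allScales`, the radial bump `stub_radialBump`, and the well-posedness
`stub_advectionDiffusionSchwartz` (W2 of the `MixingPayoff` line) for both the heat and the `u`-evolution.

Reading for the crux: for `δ ≤ δ₂` the coherence hypothesis `¬ MIX(r, δ)` of S2 / stub B holds automatically at every scale
at which the solution's drift is, on the window, `c₀ r`-close in `L∞_t L²_x` to a spherical-shell (pure swirl / differential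
rotation) flow about the point — swirl-dominated cores are coherent whatever their amplitude, and this is an open condition.
-/

noncomputable section

open Literature.Analysis.FluidPDE MeasureTheory Set Function Metric
open scoped ContDiff InnerProductSpace

-- `Summit = Problem` for this summit; the tree lakefile sets `weak.linter.dupNamespace = false`.
set_option linter.dupNamespace false

namespace Summit.NavierStokesRegularity.NavierStokesRegularity.Theorems

/-- **The heat evolution of a radial datum is not transported by a sphere-tangential vector** (the key step of
`stub_sphereTangential_notDissipatesAtScale`, recorded as a lemma): for an admissible heat solution `θ` on `[a, b] × ℝ³`
with radial datum `θ(a)`, every `t ∈ [a, b]` and every `v ⊥ x`, `⟪v, ∇θ(t, x)⟫ = 0` — `θ` is invariant under the reflection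
in `(ℝ v)ᗮ` (isometry invariance `stub_heatSolution_comp_linearIsometryEquiv` + uniqueness `stub_heatSolution_unique`), which
fixes `x` and flips `v` (`stub_inner_gradient_eq_zero_of_reflectionInvariant`). -/
theorem inner_gradient_heat_eq_zero_of_tangential {a b : ℝ} (hab : a < b)
    {θ : ℝ → EuclideanSpace ℝ (Fin 3) → ℝ}
    (hsm : IsSmoothSpaceTimeOn (Set.Icc a b) θ) (hdec : HasUniformRapidDecayOn (Set.Icc a b) θ)
    (hheat : ∀ t ∈ Set.Icc a b, ∀ x : EuclideanSpace ℝ (Fin 3),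
      timeDerivWithin (Set.Icc a b) θ t x = Laplacian.laplacian (θ t) x)
    (hrad : ∀ x y : EuclideanSpace ℝ (Fin 3), ‖x‖ = ‖y‖ → θ a x = θ a y)
    {t : ℝ} (ht : t ∈ Set.Icc a b) {v x : EuclideanSpace ℝ (Fin 3)} (hv : inner ℝ v x = 0) :
    inner ℝ v (gradient (θ t) x) = 0 := by
  set R : EuclideanSpace ℝ (Fin 3) ≃ₗᵢ[ℝ] EuclideanSpace ℝ (Fin 3) :=
    (Submodule.span ℝ {v})ᗮ.reflection with hR
  obtain ⟨hsm', hdec', hheat'⟩ := stub_heatSolution_comp_linearIsometryEquiv a b hab R θ hsm hdec hheat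
  have hdat : (fun x => θ a (R.symm x)) = θ a := by
    funext y
    exact hrad _ _ (by rw [LinearIsometryEquiv.norm_map])
  have huniq := stub_heatSolution_unique a b hab (fun t x => θ t (R.symm x)) θ hsm' hdec' hheat'
    hsm hdec hheat hdat t ht
  refine stub_inner_gradient_eq_zero_of_reflectionInvariant (θ t) v x
    (hsm.hasFDerivAt_slice ht x).differentiableAt (fun y => ?_) hv
  have h1 := huniq y
  have h2 : R.symm = R := Submodule.reflection_symm
  rw [h2] at h1
  simpa [hR] using h1

/-- **ROBUST swirl coherence** (registered sub-goal `stub_notDissipatesAtScale_of_near_sphereTangential`, lead c3).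
There are universal `δ₂, c₀ > 0` (`δ₂ = c/2`, `c₀ = c² |B₁| / 64`, `c` the heat bump floor) such that: if `v` is tangential to
the spheres about `0` on the window `S = [T − r², T − r²/2]` with `C¹`, divergence-free, square-integrable slices, and `u`
is jointly smooth with bounded derivatives on `S × ℝ³` (the well-posedness class of `stub_advectionDiffusionSchwartz`) with
divergence-free square-integrable slices, and `∫ ‖u(t) − v(t)‖² ≤ c₀ r` for every `t ∈ S` (the scale-invariant rate:
`‖u − v‖ ≤ ε/r` on a ball of radius `≍ r`), then `¬ DissipatesAtScale u T 0 r δ` for all `0 ≤ δ ≤ δ₂`. Proof: launch the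
radial bump `θ₀` by the heat equation (`θh`, which solves the `v`-equation: `inner_gradient_heat_eq_zero_of_tangential`) and
by the `u`-equation (`θu`); drift stability (`stub_mixClass_driftStability`, with `|θh| ≤ 1` from
`stub_mixClass_abs_le_of_datum`) gives `∫ (θu − θh)(T−r²/2)² ≤ c₀ r · r²/2 ≤ (c/2)² ∫θ₀²` (as `∫θ₀² ≥ |B_{r/2}|`), the heat
floor gives `c² ∫θ₀² < ∫ θh(T−r²/2)²`, so by the `L²` triangle inequality `∫ θu(T−r²/2)² > (c/2)² ∫θ₀² ≥ δ² ∫θ₀²`,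
contradicting `MIX(r, δ)` applied to the `u`-admissible `θu`. -/
theorem stub_notDissipatesAtScale_of_near_sphereTangential :
    ∃ δ₂ c₀ : ℝ, 0 < δ₂ ∧ 0 < c₀ ∧
      ∀ (u v : ℝ → EuclideanSpace ℝ (Fin 3) → EuclideanSpace ℝ (Fin 3)) (T r : ℝ), 0 < r →
      (∀ t ∈ Set.Icc (T - r ^ 2) (T - r ^ 2 / 2), ∀ x : EuclideanSpace ℝ (Fin 3), inner ℝ (v t x) x = 0) →
      (∀ t ∈ Set.Icc (T - r ^ 2) (T - r ^ 2 / 2), ContDiff ℝ 1 (v t)) →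
      (∀ t ∈ Set.Icc (T - r ^ 2) (T - r ^ 2 / 2), Literature.Analysis.FluidPDE.VectorCalculus.IsDivFree (v t)) →
      (∀ t ∈ Set.Icc (T - r ^ 2) (T - r ^ 2 / 2), MeasureTheory.MemLp (v t) 2 MeasureTheory.volume) →
      IsSmoothSpaceTimeOn (Set.Icc (T - r ^ 2) (T - r ^ 2 / 2)) u →
      (∀ n : ℕ, ∃ C : ℝ, ∀ t ∈ Set.Icc (T - r ^ 2) (T - r ^ 2 / 2), ∀ x : EuclideanSpace ℝ (Fin 3),
        ‖iteratedFDerivWithin ℝ n (Function.uncurry u)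
          (Set.Icc (T - r ^ 2) (T - r ^ 2 / 2) ×ˢ Set.univ) (t, x)‖ ≤ C) →
      (∀ t ∈ Set.Icc (T - r ^ 2) (T - r ^ 2 / 2), Literature.Analysis.FluidPDE.VectorCalculus.IsDivFree (u t)) →
      (∀ t ∈ Set.Icc (T - r ^ 2) (T - r ^ 2 / 2), MeasureTheory.MemLp (u t) 2 MeasureTheory.volume) →
      (∀ t ∈ Set.Icc (T - r ^ 2) (T - r ^ 2 / 2), ∫ x, ‖u t x - v t x‖ ^ 2 ≤ c₀ * r) →
      ∀ δ : ℝ, 0 ≤ δ → δ ≤ δ₂ → ¬ DissipatesAtScale u T 0 r δ := by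
  obtain ⟨c, hc, hHF⟩ := stub_heatBumpFloor_allScales
  -- unit-ball volume
  set V₁ : ℝ := (volume : Measure (EuclideanSpace ℝ (Fin 3))).real
      (Metric.ball (0 : EuclideanSpace ℝ (Fin 3)) 1) with hV₁
  have hV₁0 : 0 < V₁ := by
    rw [hV₁, measureReal_def]
    exact ENNReal.toReal_pos (measure_ball_pos volume _ one_pos).ne' measure_ball_lt_top.ne
  -- constants: `δ₂ = c/2`, `c₀ = c² V₁ / 64` (so that `c₀ r · r²/2 ≤ (c/2)² · (r/2)³ V₁ / 2 …`)
  refine ⟨c / 2, c ^ 2 * V₁ / 64, by positivity, by positivity, ?_⟩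
  intro u v T r hr hvtan hvC1 hvdiv hvL2 husm hubd hudiv huL2 hclose δ hδ0 hδ2 hmix
  have hr2 : 0 < r ^ 2 := by positivity
  have hab : T - r ^ 2 < T - r ^ 2 / 2 := by linarith
  -- the radial bump and its HEAT evolution `θh`
  obtain ⟨θ₀, hθ₀s, hθ₀c, hθ₀0, hθ₀1, hone, hsupp, hrad⟩ := stub_radialBump r hr
  have hz : IsSmoothSpaceTimeOn (Set.Icc (T - r ^ 2) (T - r ^ 2 / 2))
      (fun (_ : ℝ) (_ : EuclideanSpace ℝ (Fin 3)) => (0 : EuclideanSpace ℝ (Fin 3))) :=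
    contDiffOn_const
  have hzb : ∀ n : ℕ, ∃ C : ℝ, ∀ t ∈ Set.Icc (T - r ^ 2) (T - r ^ 2 / 2), ∀ x : EuclideanSpace ℝ (Fin 3),
      ‖iteratedFDerivWithin ℝ n (Function.uncurry
        (fun (_ : ℝ) (_ : EuclideanSpace ℝ (Fin 3)) => (0 : EuclideanSpace ℝ (Fin 3))))
        (Set.Icc (T - r ^ 2) (T - r ^ 2 / 2) ×ˢ Set.univ) (t, x)‖ ≤ C := by
    intro n
    refine ⟨0, fun t _ x => ?_⟩
    have h0 : Function.uncurry (fun (_ : ℝ) (_ : EuclideanSpace ℝ (Fin 3)) =>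
        (0 : EuclideanSpace ℝ (Fin 3))) = fun _ => 0 := by
      funext p; rfl
    rw [h0, iteratedFDerivWithin_fun_zero]
    simp
  obtain ⟨θh, hhsm, hhdec, hhpde0, hha⟩ :=
    stub_advectionDiffusionSchwartz (T - r ^ 2) (T - r ^ 2 / 2) hab _ hz hzb θ₀ hθ₀s hθ₀c
  have hheat : ∀ t ∈ Set.Icc (T - r ^ 2) (T - r ^ 2 / 2), ∀ x : EuclideanSpace ℝ (Fin 3),
      timeDerivWithin (Set.Icc (T - r ^ 2) (T - r ^ 2 / 2)) θh t x = Laplacian.laplacian (θh t) x := by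
    intro t ht x
    have h := hhpde0 t ht x
    rwa [inner_zero_left, add_zero] at h
  -- `θh` solves the `v`-equation (tangential drift, radial solution)
  have hradh : ∀ x y : EuclideanSpace ℝ (Fin 3), ‖x‖ = ‖y‖ → θh (T - r ^ 2) x = θh (T - r ^ 2) y := by
    intro x y hxy; rw [hha]; exact hrad x y hxy
  have hvpde : ∀ t ∈ Set.Icc (T - r ^ 2) (T - r ^ 2 / 2), ∀ x : EuclideanSpace ℝ (Fin 3),
      timeDerivWithin (Set.Icc (T - r ^ 2) (T - r ^ 2 / 2)) θh t x + inner ℝ (v t x) (gradient (θh t) x)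
        = Laplacian.laplacian (θh t) x := by
    intro t ht x
    rw [inner_gradient_heat_eq_zero_of_tangential hab hhsm hhdec hheat hradh ht (hvtan t ht x), add_zero]
    exact hheat t ht x
  -- the `u`-evolution `θu` of the same datum (W2 with the drift `u`)
  obtain ⟨θu, husm', hudec', hupde, hua⟩ :=
    stub_advectionDiffusionSchwartz (T - r ^ 2) (T - r ^ 2 / 2) hab u husm hubd θ₀ hθ₀s hθ₀c
  -- max principle for the heat solution: `|θh| ≤ 1`
  have hM : ∀ t ∈ Set.Icc (T - r ^ 2) (T - r ^ 2 / 2), ∀ x : EuclideanSpace ℝ (Fin 3), |θh t x| ≤ 1 := by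
    refine stub_mixClass_abs_le_of_datum (T - r ^ 2) (T - r ^ 2 / 2) hab (fun _ _ => 0) θh 0 1 hhsm hhdec
      hhpde0 (fun t _ x => by simp) (fun x => ?_)
    rw [hha, abs_le]
    exact ⟨by linarith [hθ₀0 x], hθ₀1 x⟩
  -- drift stability: `∫ (θu − θh)(t)² ≤ 1² · (c₀ r) · (t − a)`
  have huC1 : ∀ t ∈ Set.Icc (T - r ^ 2) (T - r ^ 2 / 2), ContDiff ℝ 1 (u t) := fun t ht =>
    (husm.contDiff_slice ht).of_le (by norm_cast)
  have hdat : θu (T - r ^ 2) = θh (T - r ^ 2) := by rw [hua, hha]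
  have hstab := stub_mixClass_driftStability (T - r ^ 2) (T - r ^ 2 / 2) hab u v θu θh husm' hudec' hupde
    hhsm hhdec hvpde huC1 hudiv huL2 hvC1 hvdiv hvL2 hdat 1 (c ^ 2 * V₁ / 64 * r) hM hclose
    (T - r ^ 2 / 2) ⟨hab.le, le_rfl⟩
  have hWle : ∫ x, (θu (T - r ^ 2 / 2) x - θh (T - r ^ 2 / 2) x) ^ 2 ≤ c ^ 2 * V₁ / 64 * r * (r ^ 2 / 2) := by
    have h : (1 : ℝ) ^ 2 * (c ^ 2 * V₁ / 64 * r) * (T - r ^ 2 / 2 - (T - r ^ 2)) =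
        c ^ 2 * V₁ / 64 * r * (r ^ 2 / 2) := by ring
    rw [← h]; exact hstab
  -- MIX applied to `θu`
  have hsuppu : Function.support (θu (T - r ^ 2)) ⊆ Metric.ball (0 : EuclideanSpace ℝ (Fin 3)) r := by
    rw [hua]; exact hsupp
  have hA : ∫ x, (θu (T - r ^ 2 / 2) x) ^ 2 ≤ δ ^ 2 * ∫ x, (θ₀ x) ^ 2 := by
    have h := hmix θu husm' hudec' hupde hsuppu
    rwa [hua] at h
  -- heat floor for `θh`
  have hsupph : Function.support (θh (T - r ^ 2)) ⊆ Metric.ball (0 : EuclideanSpace ℝ (Fin 3)) r := by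
    rw [hha]; exact hsupp
  have hB : c ^ 2 * ∫ x, (θ₀ x) ^ 2 < ∫ x, (θh (T - r ^ 2 / 2) x) ^ 2 := by
    have h := hHF T r 0 hr θh hhsm hhdec hheat
      (fun x => by rw [hha]; exact hθ₀0 x) (fun x => by rw [hha]; exact hθ₀1 x)
      (fun x hx => by rw [hha]; exact hone x hx) hsupph
    rwa [hha] at h
  -- mass of the datum from below: `(r/2)³ V₁ ≤ ∫ θ₀²`
  have hint0 : Integrable (fun x => (θ₀ x) ^ 2) := by
    have h := typeIFloor_integrable_sq_slice hhsm hhdec (t := T - r ^ 2) ⟨le_rfl, hab.le⟩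
    rwa [hha] at h
  have hX : 1 ^ 2 * ((r / 2) ^ 3 * V₁) ≤ ∫ x, (θ₀ x) ^ 2 :=
    typeIFloor_le_integral_sq_of_floor hr.le zero_le_one hint0 (fun x hx => (hone x hx).symm.le)
  rw [one_pow, one_mul] at hX
  -- the `L²` triangle inequality `√∫θh² ≤ √∫θu² + √∫w²` in squared form via Cauchy–Schwarz
  set A : ℝ := ∫ x, (θu (T - r ^ 2 / 2) x) ^ 2 with hAdef
  set Bh : ℝ := ∫ x, (θh (T - r ^ 2 / 2) x) ^ 2 with hBdef
  set W : ℝ := ∫ x, (θu (T - r ^ 2 / 2) x - θh (T - r ^ 2 / 2) x) ^ 2 with hWdef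
  set X : ℝ := ∫ x, (θ₀ x) ^ 2 with hXdef
  have htb : T - r ^ 2 / 2 ∈ Set.Icc (T - r ^ 2) (T - r ^ 2 / 2) := ⟨hab.le, le_rfl⟩
  have hintu : Integrable (fun x => (θu (T - r ^ 2 / 2) x) ^ 2) := typeIFloor_integrable_sq_slice husm' hudec' htb
  have hinth : Integrable (fun x => (θh (T - r ^ 2 / 2) x) ^ 2) := typeIFloor_integrable_sq_slice hhsm hhdec htb
  have hmemu : MemLp (θu (T - r ^ 2 / 2)) 2 volume := by
    refine (memLp_two_iff_integrable_sq ?_).2 hintu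
    exact (husm'.continuous_slice htb).aestronglyMeasurable
  have hmemh : MemLp (θh (T - r ^ 2 / 2)) 2 volume := by
    refine (memLp_two_iff_integrable_sq ?_).2 hinth
    exact (hhsm.continuous_slice htb).aestronglyMeasurable
  have hA0 : 0 ≤ A := integral_nonneg fun _ => sq_nonneg _
  have hW0 : 0 ≤ W := integral_nonneg fun _ => sq_nonneg _
  have hX0 : 0 ≤ X := integral_nonneg fun _ => sq_nonneg _
  -- Cauchy–Schwarz: `|∫ θu · w| ≤ √A √W`
  have hCS : |∫ x, θu (T - r ^ 2 / 2) x * (θu (T - r ^ 2 / 2) x - θh (T - r ^ 2 / 2) x)| ≤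
      Real.sqrt A * Real.sqrt W := by
    have hmemw : MemLp (fun x => θu (T - r ^ 2 / 2) x - θh (T - r ^ 2 / 2) x) 2 volume := hmemu.sub hmemh
    have hfa : MemLp (fun x => |θu (T - r ^ 2 / 2) x|) 2 volume := hmemu.abs
    have hga : MemLp (fun x => |θu (T - r ^ 2 / 2) x - θh (T - r ^ 2 / 2) x|) 2 volume := hmemw.abs
    have h := integral_mul_le_Lp_mul_Lq_of_nonneg (p := 2) (q := 2) (μ := volume)
      (f := fun x => |θu (T - r ^ 2 / 2) x|) (g := fun x => |θu (T - r ^ 2 / 2) x - θh (T - r ^ 2 / 2) x|)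
      ⟨by norm_num, by norm_num, by norm_num⟩
      (Filter.Eventually.of_forall fun _ => abs_nonneg _) (Filter.Eventually.of_forall fun _ => abs_nonneg _)
      (by simpa using hfa) (by simpa using hga)
    have habs : |∫ x, θu (T - r ^ 2 / 2) x * (θu (T - r ^ 2 / 2) x - θh (T - r ^ 2 / 2) x)| ≤
        ∫ x, |θu (T - r ^ 2 / 2) x| * |θu (T - r ^ 2 / 2) x - θh (T - r ^ 2 / 2) x| := by
      refine (abs_integral_le_integral_abs).trans (le_of_eq ?_)
      congr 1; funext x; exact abs_mul _ _
    refine habs.trans (h.trans (le_of_eq ?_))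
    have e1 : (∫ x, |θu (T - r ^ 2 / 2) x| ^ (2 : ℝ)) = A := by
      rw [hAdef]; congr 1; funext x; rw [Real.rpow_two, sq_abs]
    have e2 : (∫ x, |θu (T - r ^ 2 / 2) x - θh (T - r ^ 2 / 2) x| ^ (2 : ℝ)) = W := by
      rw [hWdef]; congr 1; funext x; rw [Real.rpow_two, sq_abs]
    rw [e1, e2, Real.sqrt_eq_rpow, Real.sqrt_eq_rpow]
  -- `Bh = A − 2∫θu w + W ≤ (√A + √W)²`
  have hBle : Bh ≤ (Real.sqrt A + Real.sqrt W) ^ 2 := by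
    have hexp : Bh = A - 2 * (∫ x, θu (T - r ^ 2 / 2) x * (θu (T - r ^ 2 / 2) x - θh (T - r ^ 2 / 2) x)) + W := by
      have hint1 : Integrable (fun x => θu (T - r ^ 2 / 2) x * (θu (T - r ^ 2 / 2) x - θh (T - r ^ 2 / 2) x)) :=
        hmemu.integrable_mul (hmemu.sub hmemh)
      have hintW : Integrable (fun x => (θu (T - r ^ 2 / 2) x - θh (T - r ^ 2 / 2) x) ^ 2) :=
        (memLp_two_iff_integrable_sq ((hmemu.sub hmemh).aestronglyMeasurable)).1 (hmemu.sub hmemh)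
      have hpt : (fun x => (θh (T - r ^ 2 / 2) x) ^ 2) = fun x =>
          ((θu (T - r ^ 2 / 2) x) ^ 2 - 2 * (θu (T - r ^ 2 / 2) x * (θu (T - r ^ 2 / 2) x - θh (T - r ^ 2 / 2) x)))
            + (θu (T - r ^ 2 / 2) x - θh (T - r ^ 2 / 2) x) ^ 2 := by
        funext x; ring
      have h2 : Integrable (fun x => 2 * (θu (T - r ^ 2 / 2) x * (θu (T - r ^ 2 / 2) x - θh (T - r ^ 2 / 2) x))) :=
        hint1.const_mul 2
      have hI1 : Integrable (fun x => (θu (T - r ^ 2 / 2) x) ^ 2 -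
          2 * (θu (T - r ^ 2 / 2) x * (θu (T - r ^ 2 / 2) x - θh (T - r ^ 2 / 2) x))) := hintu.sub h2
      rw [hBdef, hpt, integral_add hI1 hintW, integral_sub hintu h2, integral_const_mul]
    rw [hexp]
    have hsA := Real.sq_sqrt hA0
    have hsW := Real.sq_sqrt hW0
    nlinarith [hCS, abs_le.1 hCS, Real.sqrt_nonneg A, Real.sqrt_nonneg W]
  -- numerics: `√W ≤ (c/2) √X`, `c √X < √Bh`, hence `(c/2) √X < √A`, so `A > (c/2)² X ≥ δ² X ≥ A`
  have hWX : Real.sqrt W ≤ c / 2 * Real.sqrt X := by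
    have h1 : W ≤ (c / 2) ^ 2 * ((r / 2) ^ 3 * V₁) := by
      have : c ^ 2 * V₁ / 64 * r * (r ^ 2 / 2) ≤ (c / 2) ^ 2 * ((r / 2) ^ 3 * V₁) := by nlinarith
      exact hWle.trans this
    have h2 : W ≤ (c / 2 * Real.sqrt X) ^ 2 := by
      rw [mul_pow, Real.sq_sqrt hX0]
      exact h1.trans (by nlinarith)
    calc Real.sqrt W ≤ Real.sqrt ((c / 2 * Real.sqrt X) ^ 2) := Real.sqrt_le_sqrt h2
      _ = c / 2 * Real.sqrt X := Real.sqrt_sq (by positivity)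
  have hXB : c * Real.sqrt X < Real.sqrt Bh := by
    have h1 : (c * Real.sqrt X) ^ 2 < Bh := by rw [mul_pow, Real.sq_sqrt hX0]; exact hB
    calc c * Real.sqrt X = Real.sqrt ((c * Real.sqrt X) ^ 2) := (Real.sqrt_sq (by positivity)).symm
      _ < Real.sqrt Bh := Real.sqrt_lt_sqrt (by positivity) h1
  have hBsq : Real.sqrt Bh ≤ Real.sqrt A + Real.sqrt W := by
    calc Real.sqrt Bh ≤ Real.sqrt ((Real.sqrt A + Real.sqrt W) ^ 2) := Real.sqrt_le_sqrt hBle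
      _ = Real.sqrt A + Real.sqrt W := Real.sqrt_sq (by positivity)
  have hAlow : c / 2 * Real.sqrt X < Real.sqrt A := by linarith
  have hAX : (c / 2) ^ 2 * X < A := by
    have h1 : (c / 2 * Real.sqrt X) ^ 2 < (Real.sqrt A) ^ 2 :=
      pow_lt_pow_left₀ hAlow (by positivity) two_ne_zero
    rwa [mul_pow, Real.sq_sqrt hX0, Real.sq_sqrt hA0] at h1
  have hδc : δ ^ 2 ≤ (c / 2) ^ 2 := pow_le_pow_left₀ hδ0 hδ2 2
  have : A ≤ (c / 2) ^ 2 * X := hA.trans (mul_le_mul_of_nonneg_right hδc hX0)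
  linarith

end Summit.NavierStokesRegularity.NavierStokesRegularity.Theorems

end
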